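import Literature.AlgebraicGeometry.Resolution.AffineBlowup
import Literature.AlgebraicGeometry.Resolution.ResolutionOfSingularities
import Literature.AlgebraicGeometry.Resolution.ArithmeticalThreefolds
import Mathlib.AlgebraicGeometry.AffineScheme
import Mathlib.RingTheory.RegularLocalRing.Defs
import Mathlib.RingTheory.KrullDimension.Zero
import Mathlib.RingTheory.FiniteType
import Mathlib.Algebra.Field.Equiv
import HarnessLib

/-!
# One-shot resolution in dimension zero (`stub_oneShotDimZero`, the instance `OneShot p 1`)

Crux stmt-ResolutionOfSingularities-15960 (`SectionAscent.FibrewiseClosedPoints`), line `registered`,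
stub `stub_oneShotDimZero`: the dimension-`0` base instance `OneShot p 1` of strong one-shot affine
resolution — every integral affine `Spec A` of finite type over a field of characteristic `p` with
`dim A < 1` has an ideal `I ≠ 0` whose blowing up `Bl_I(Spec A) = affineBlowup I` is regular and
whose zero set is exactly the non-regular locus of `Spec A`.

Proof: a domain of Krull dimension `< 1` has dimension `≤ 0`, hence is a field
(`Ring.KrullDimLE.isField_of_isDomain`). Take `I = ⊤ ∋ 1`: the open immersion
`awayι 1 : Spec A[1/1] → Bl_⊤(Spec A)` has range `π⁻¹(D(1)) = Bl_⊤(Spec A)`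
(`affineBlowup.range_awayι`), so every stalk of the blowing up is a local ring of the field
`A[1/1]`, i.e. a field, hence regular; and for every prime `𝔭` of the field `A` both `⊤ ≤ 𝔭` and
"`A_𝔭` is not regular" are false (`A_𝔭` is again a field).

References: The Stacks Project, Tag 0804 (charts of the blowing up), Tag 00KU (regular local
rings); the rest is folklore.
-/

-- single-problem summit: the doubled namespace component is forced
set_option linter.dupNamespace false

noncomputable section

namespace Summit.ResolutionOfSingularities.ResolutionOfSingularities.Theorems.SectionAscent.OneShotDimZero

open AlgebraicGeometry CategoryTheory Literature.AlgebraicGeometry.Resolution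

/-- A localization of a field at a submonoid avoiding `0` is a field (the localization map is
bijective, Mathlib `IsField.localization_map_bijective`). [folklore] -/
theorem isField_of_isLocalization {F S : Type*} [CommRing F] [CommRing S] [Algebra F S]
    (M : Submonoid F) [IsLocalization M S] (hM : (0 : F) ∉ M) (hF : IsField F) : IsField S :=
  MulEquiv.isField hF
    (RingEquiv.ofBijective (algebraMap F S) (hF.localization_map_bijective hM)).symm.toMulEquiv

/-- The local rings `F_𝔮` of a field `F` are regular local rings (they are fields; tree
`isRegularLocalRing_of_isField`). [folklore] -/
theorem isRegularLocalRing_atPrime_of_isField {F : Type*} [CommRing F] (hF : IsField F)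
    (q : Ideal F) [q.IsPrime] : IsRegularLocalRing (Localization.AtPrime q) :=
  Literature.AlgebraicGeometry.Resolution.isRegularLocalRing_of_isField
    (isField_of_isLocalization (S := Localization.AtPrime q) q.primeCompl
      (fun h => h (Ideal.zero_mem q)) hF)

/-- **The blowing up of a field along the unit ideal is regular**: for a field `A` (given as
`IsField A`), every stalk of `Bl_⊤(Spec A) = Proj A[t]` is a regular local ring — the open
immersion `Spec A[1/1] → Bl_⊤(Spec A)` is surjective (its range is `π⁻¹(D(1))`), and the local
rings of the field `A[1/1]` are fields. [cite: StacksProject, Tag 0804] -/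
theorem isRegular_affineBlowup_top_of_isField (A : Type) [CommRing A] (hF : IsField A) :
    Literature.AlgebraicGeometry.Resolution.Scheme.IsRegular
      (Literature.AlgebraicGeometry.Resolution.affineBlowup (⊤ : Ideal A)) := by
  letI : Nontrivial A := hF.nontrivial
  intro x
  have h1 : (1 : A) ∈ (⊤ : Ideal A) := Submodule.mem_top
  -- every point lies in the image of `Spec A[1/1]`
  have hx : x ∈ Set.range (affineBlowup.awayι (I := (⊤ : Ideal A)) 1 h1) := by
    rw [affineBlowup.range_awayι]
    change (1 : A) ∉ (((affineBlowup.π (⊤ : Ideal A)).base x : PrimeSpectrum A).asIdeal)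
    exact (Ideal.ne_top_iff_one _).mp (Ideal.IsPrime.ne_top inferInstance)
  obtain ⟨z, rfl⟩ := hx
  -- `A[1/1]` is a field, so its local ring at `z` is regular
  have h0 : (0 : A) ∉ Submonoid.powers (1 : A) := by
    rw [Submonoid.powers_one, Submonoid.mem_bot]
    exact zero_ne_one
  haveI := isRegularLocalRing_atPrime_of_isField
    (isField_of_isLocalization (S := Localization.Away (1 : A)) (Submonoid.powers (1 : A)) h0 hF)
    z.asIdeal
  -- and the stalk of the blowing up at `awayι z` is that local ring
  exact IsRegularLocalRing.of_ringEquiv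
    (((asIso ((affineBlowup.awayι (I := (⊤ : Ideal A)) 1 h1).stalkMap z)).commRingCatIsoToRingEquiv).trans
      (Spec.stalkIso (.of (Localization.Away (1 : A))) z).commRingCatIsoToRingEquiv).symm

/-- STUB `stub_oneShotDimZero` of line `registered` (crux `SectionAscent.FibrewiseClosedPoints`):
**strong one-shot affine resolution in dimension zero**, the instance `OneShot p 1`. An integral
affine `Spec A` of finite type over a field `K` of characteristic `p` with `dim A < 1` is the
spectrum of a field; `I = ⊤ ≠ 0` has regular blowing up `Bl_⊤(Spec A) ≅ Spec A` and
`V(⊤) = ∅ = Sing(Spec A)`. (The hypotheses `hp`, `CharP`, `Algebra K A`, `FiniteType` are idle.)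
[cite: StacksProject, Tag 0804] -/
theorem stub_oneShotDimZero (p : ℕ) (hp : p.Prime) (K : Type) [Field K] [CharP K p] (A : Type)
    [CommRing A] [IsDomain A] [Algebra K A] [Algebra.FiniteType K A]
    (hdim : ringKrullDim A < ((1 : ℕ) : WithBot ℕ∞)) :
    ∃ I : Ideal A, I ≠ ⊥ ∧
      Literature.AlgebraicGeometry.Resolution.Scheme.IsRegular
        (Literature.AlgebraicGeometry.Resolution.affineBlowup I) ∧
      ∀ 𝔭 : PrimeSpectrum A, I ≤ 𝔭.asIdeal ↔ ¬ IsRegularLocalRing (Localization.AtPrime 𝔭.asIdeal) := by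
  have _hp := hp
  -- `A` is a field: a domain of Krull dimension `< 1`, i.e. `≤ 0`
  have h0 : ringKrullDim A ≤ (0 : ℕ) := by
    rw [← ENat.WithBot.lt_add_one_iff]
    simpa using hdim
  haveI : Ring.KrullDimLE 0 A := Ring.krullDimLE_iff.mpr h0
  have hF : IsField A := Ring.KrullDimLE.isField_of_isDomain
  refine ⟨⊤, top_ne_bot, isRegular_affineBlowup_top_of_isField A hF, fun 𝔭 => ?_⟩
  -- exact support: `⊤ ≤ 𝔭` is false, and `A_𝔭` (a field) is regular
  haveI := isRegularLocalRing_atPrime_of_isField hF 𝔭.asIdeal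
  exact iff_of_false (fun h => 𝔭.isPrime.ne_top (top_le_iff.mp h)) (not_not.mpr ‹_›)

end Summit.ResolutionOfSingularities.ResolutionOfSingularities.Theorems.SectionAscent.OneShotDimZero

end
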